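import Mathlib
import HarnessLib
import Summits.ResolutionOfSingularities.ResolutionOfSingularities.Theorems.WildQuotientsWildQuotientResolutionZ9PeeledTwistedKL

/-!
# ℤ9 SPECIMEN (peeled `𝔸⁴/ℤ9`, char 3), brick Z4T part 2b: finiteness data of the twisted lift
# (`⟨σ̃⟩` finite of order 3; `L` a domain of finite type; `L^{σ̃}` of finite type over `k`)
(crux stmt-ResolutionOfSingularities-15640 `WildQuotients.WildQuotientResolution`, line `Sketch`; S1 =
stmt-ResolutionOfSingularities-17941; chain w45c card-P specimen «peeled 𝔸⁴/ℤ9», V-BR, brick Z4T; the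
`Algebra.FiniteType k S` conjunct of the per-piece chart datum `hchart` of the Z6 frame
`PeelingFrame.hasResolution_glued_liftAction_of_pieceGradedCharts` for the piece `P_T`.)
[OURS · L1 W4.5c] — NOT a statement of any manuscript; AI-produced, kernel-checked ≠ expert-reviewed.
Def-free, law-based over `…Z9PeeledTwistedLift` / `…TwistedKL`.

* `isDomain_L`, `finiteType_L` — `L = k[x][u⁻¹]` is a domain of finite type over `k`;
* `finite_zpowers_twistedLift` — `⟨σ̃⟩` is finite (order `3`: `σ̃ ^ 3 = 1`, `σ̃ ≠ 1`);
* **`twistedLift_fixedPoints_finiteType`** — `L^{σ̃}` is of finite type over `k` (E. Noether, Literature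
  instance `finiteType_fixedPointsSubalgebra`).
-/

-- single-problem summit: the doubled namespace component `ResolutionOfSingularities` is forced
set_option linter.dupNamespace false

noncomputable section

open MvPolynomial

namespace Summit.ResolutionOfSingularities.ResolutionOfSingularities.Theorems.WildQuotientResolution.Z9Peeled

variable (k : Type) [Field k] (n : ℕ) (a b : Fin n)

/-- `u = 1 − S⁶α²` (local shorthand; slots `S = X b`, `α = X a`). -/
local notation3 "uT" => (1 - X b ^ 6 * X a ^ 2 : MvPolynomial (Fin n) k)
/-- `v = 1 + S³α` (local shorthand). -/
local notation3 "vT" => (1 + X b ^ 3 * X a : MvPolynomial (Fin n) k)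
/-- The twisted root chart ring `L = k[x][u⁻¹]` (local shorthand). -/
local notation3 "LT" => Localization.Away (1 - X b ^ 6 * X a ^ 2 : MvPolynomial (Fin n) k)
/-- `ι : k[x] → L` (local shorthand). -/
local notation3 "ιT" => algebraMap (MvPolynomial (Fin n) k)
  (Localization.Away (1 - X b ^ 6 * X a ^ 2 : MvPolynomial (Fin n) k))

/-- `L = k[x][u⁻¹]` is a domain. [folklore] -/
theorem isDomain_L : IsDomain LT :=
  IsLocalization.isDomain_of_le_nonZeroDivisors _
    (powers_le_nonZeroDivisors_of_noZeroDivisors (u_ne_zero k n a b))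

/-- `L = k[x][u⁻¹]` is of finite type over `k`. [folklore] -/
theorem finiteType_L : Algebra.FiniteType k LT :=
  haveI : Algebra.FiniteType (MvPolynomial (Fin n) k) LT :=
    IsLocalization.finiteType_of_monoid_fg (Submonoid.powers uT) LT
  Algebra.FiniteType.trans (S := MvPolynomial (Fin n) k) inferInstance inferInstance

/-- `⟨σ̃⟩` is finite: `σ̃` has order `3`. [OURS · L1 W4.5c] -/
theorem finite_zpowers_twistedLift (σt : LT ≃ₐ[k] LT) (hS : σt (ιT (X b)) = ιT (X b * vT))
    (hσt3 : σt ^ 3 = 1) : Finite ↥(Subgroup.zpowers σt) := by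
  haveI : Fact (Nat.Prime 3) := ⟨Nat.prime_three⟩
  refine Nat.finite_of_card_ne_zero ?_
  rw [Nat.card_zpowers, orderOf_eq_prime hσt3 (twistedLift_ne_one k n a b σt hS)]
  norm_num

/-- **`L^{σ̃}` is of finite type over `k`** (E. Noether). [OURS · L1 W4.5c] -/
theorem twistedLift_fixedPoints_finiteType (σt : LT ≃ₐ[k] LT)
    (hS : σt (ιT (X b)) = ιT (X b * vT)) (hσt3 : σt ^ 3 = 1) :
    Algebra.FiniteType k (FixedPoints.subalgebra k LT (Subgroup.zpowers σt)) := by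
  haveI := finite_zpowers_twistedLift k n a b σt hS hσt3
  haveI := finiteType_L k n a b
  infer_instance

end Summit.ResolutionOfSingularities.ResolutionOfSingularities.Theorems.WildQuotientResolution.Z9Peeled

end
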